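import Mathlib
import Summits.Ventures.PercRepro2.ZMeanProof
import Summits.Ventures.PercRepro2.PendantRoot

/-!
# The two-edge star at `a₃`: `a₃` adjacent only to the two roots (blind cell PercRepro2, night-1 g6;
exploration lens, NIGHT1-G6.md §7)

`a₃` carries exactly the edges `f₁ = {a₃, a₁}` and `f₂ = {a₃, a₂}`.  Unless BOTH are open the vertex
`a₃` is a leaf or isolated and the connections among the other vertices are those of the
configuration with both edges closed (`closeStar`; `conn_closeStar_iff`).  Exploring `C(a₃)`:
both closed ⇒ `{a₃}`; `f₂` open, `f₁` closed ⇒ `C(a₂)`; `f₁` open, `f₂` closed ⇒ `C(a₁)`; both open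
⇒ the cluster contains both roots (and `Q` fails).  The residual connection events of the isolated
`a₃` (`connDelEvent ends {a₃}`) are the `closeStar` connections (`connDelEvent_star`).
-/

namespace Summit.Ventures.PercRepro2

open UnionCluster CovForm PendantRoot

namespace HMFTwoRoot

variable {V : Type*} {E : Type*} [Fintype E] [DecidableEq E] [Fintype V] [DecidableEq V]
  {R : Type*} [Field R] [LinearOrder R] [IsStrictOrderedRing R]

section Star

variable {ends : E → Sym2 V} {f₁ f₂ : E} {a₃ a₁ a₂ : V}

/-- The configuration with both star edges closed. -/
def closeStar (f₁ f₂ : E) (ω : Config E) : Config E :=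
  Function.update (Function.update ω f₁ false) f₂ false

omit [Fintype E] [Fintype V] [DecidableEq V] in
/-- `closeStar` agrees with `ω` off the star. -/
lemma closeStar_apply_of_ne {ω : Config E} {e : E} (h1 : e ≠ f₁) (h2 : e ≠ f₂) :
    closeStar f₁ f₂ ω e = ω e := by
  simp [closeStar, Function.update_of_ne h1, Function.update_of_ne h2]

omit [Fintype E] [Fintype V] [DecidableEq V] in
/-- The star edges are closed in `closeStar`. -/
lemma closeStar_apply_f₁ (ω : Config E) : closeStar f₁ f₂ ω f₁ = false := by
  by_cases h : f₁ = f₂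
  · subst h; simp [closeStar]
  · simp [closeStar, Function.update_of_ne h]

omit [Fintype E] [Fintype V] [DecidableEq V] in
/-- The star edges are closed in `closeStar`. -/
lemma closeStar_apply_f₂ (ω : Config E) : closeStar f₁ f₂ ω f₂ = false := by
  simp [closeStar]

omit [Fintype E] [Fintype V] [DecidableEq V] in
/-- `closeStar ω ≤ ω`. -/
lemma closeStar_le (ω : Config E) : closeStar f₁ f₂ ω ≤ ω := by
  intro e
  by_cases h1 : e = f₁
  · subst h1; rw [closeStar_apply_f₁]; exact Bool.false_le _
  by_cases h2 : e = f₂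
  · subst h2; rw [closeStar_apply_f₂]; exact Bool.false_le _
  rw [closeStar_apply_of_ne h1 h2]

omit [Fintype E] [DecidableEq E] [Fintype V] [DecidableEq V] in
/-- An edge at `a₃` is a star edge. -/
lemma star_edge (hstar : ∀ e, a₃ ∈ ends e → e = f₁ ∨ e = f₂) {e : E} {y : V}
    (h : ends e = s(a₃, y)) : e = f₁ ∨ e = f₂ :=
  hstar e (by rw [h]; exact Sym2.mem_mk_left _ _)

omit [Fintype E] [Fintype V] [DecidableEq V] in
/-- In `closeStar ω` the vertex `a₃` is isolated. -/
lemma not_conn_closeStar_a3 (hstar : ∀ e, a₃ ∈ ends e → e = f₁ ∨ e = f₂) {ω : Config E} {x : V}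
    (hx : x ≠ a₃) : ¬ Conn ends (closeStar f₁ f₂ ω) x a₃ := by
  intro h
  have key := mem_of_conn_of_closed (ends := ends) (ω := closeStar f₁ f₂ ω) (S := {w | w ≠ a₃})
    (fun w hw u hwu => ?_) hx h
  · exact key rfl
  · obtain ⟨_, e', he', hends'⟩ := openGraph_adj.1 hwu
    intro hu
    subst hu
    rcases star_edge hstar (by rw [hends', Sym2.eq_swap]) with rfl | rfl
    · rw [closeStar_apply_f₁] at he'; exact Bool.false_ne_true he'
    · rw [closeStar_apply_f₂] at he'; exact Bool.false_ne_true he'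

omit [Fintype E] [Fintype V] [DecidableEq V] in
/-- **Connections off the star**: unless both star edges are open, a connection between two vertices
other than `a₃` does not use the star. -/
lemma conn_closeStar_of_conn (hf₁ : ends f₁ = s(a₃, a₁)) (hf₂ : ends f₂ = s(a₃, a₂))
    (hstar : ∀ e, a₃ ∈ ends e → e = f₁ ∨ e = f₂)
    {ω : Config E} (hnb : ¬ (ω f₁ = true ∧ ω f₂ = true)) {x v : V} (hx : x ≠ a₃) (hv : v ≠ a₃)
    (h : Conn ends ω x v) : Conn ends (closeStar f₁ f₂ ω) x v := by
  set ω' := closeStar f₁ f₂ ω with hω'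
  let S : Set V := {y | Conn ends ω' x y ∨
    (y = a₃ ∧ ((ω f₁ = true ∧ Conn ends ω' x a₁) ∨ (ω f₂ = true ∧ Conn ends ω' x a₂)))}
  have hS : ∀ y ∈ S, ∀ z, (openGraph ends ω).Adj y z → z ∈ S := by
    intro y hy z hyz
    obtain ⟨hne, e, he, hends⟩ := openGraph_adj.1 hyz
    by_cases hy3 : y = a₃
    · subst hy3
      have hin : (ω f₁ = true ∧ Conn ends ω' x a₁) ∨ (ω f₂ = true ∧ Conn ends ω' x a₂) := by
        rcases hy with hc | ⟨_, hin⟩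
        · exact absurd hc (not_conn_closeStar_a3 hstar hx)
        · exact hin
      rcases star_edge hstar hends with rfl | rfl
      · have hz : z = a₁ := by
          rw [hf₁] at hends
          rcases Sym2.eq_iff.1 hends with ⟨_, h⟩ | ⟨h, _⟩
          · exact h.symm
          · exact absurd h hne
        subst hz
        rcases hin with ⟨_, hc⟩ | ⟨hf2, _⟩
        · exact Or.inl hc
        · exact absurd ⟨he, hf2⟩ hnb
      · have hz : z = a₂ := by
          rw [hf₂] at hends
          rcases Sym2.eq_iff.1 hends with ⟨_, h⟩ | ⟨h, _⟩
          · exact h.symm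
          · exact absurd h hne
        subst hz
        rcases hin with ⟨hf1, _⟩ | ⟨_, hc⟩
        · exact absurd ⟨hf1, he⟩ hnb
        · exact Or.inl hc
    · have hcy : Conn ends ω' x y := by
        rcases hy with hc | ⟨h3, _⟩
        · exact hc
        · exact absurd h3 hy3
      by_cases hz3 : z = a₃
      · rw [hz3] at hends
        rw [hz3]
        rcases star_edge hstar (by rw [hends, Sym2.eq_swap]) with rfl | rfl
        · have hy1 : y = a₁ := by
            rw [hf₁] at hends
            rcases Sym2.eq_iff.1 hends with ⟨h, _⟩ | ⟨_, h⟩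
            · exact absurd h.symm hy3
            · exact h.symm
          rw [hy1] at hcy
          exact Or.inr ⟨rfl, Or.inl ⟨he, hcy⟩⟩
        · have hy2 : y = a₂ := by
            rw [hf₂] at hends
            rcases Sym2.eq_iff.1 hends with ⟨h, _⟩ | ⟨_, h⟩
            · exact absurd h.symm hy3
            · exact h.symm
          rw [hy2] at hcy
          exact Or.inr ⟨rfl, Or.inr ⟨he, hcy⟩⟩
      · have hne1 : e ≠ f₁ := by
          rintro rfl
          rw [hf₁] at hends
          rcases Sym2.eq_iff.1 hends with ⟨h, _⟩ | ⟨h, _⟩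
          · exact hy3 h.symm
          · exact hz3 h.symm
        have hne2 : e ≠ f₂ := by
          rintro rfl
          rw [hf₂] at hends
          rcases Sym2.eq_iff.1 hends with ⟨h, _⟩ | ⟨h, _⟩
          · exact hy3 h.symm
          · exact hz3 h.symm
        have he' : ω' e = true := by rw [hω', closeStar_apply_of_ne hne1 hne2]; exact he
        exact Or.inl (conn_trans hcy (conn_of_openAdj ⟨e, he', hends⟩))
  have hvS : v ∈ S := mem_of_conn_of_closed hS (Or.inl (conn_refl ends ω' x)) h
  rcases hvS with hc | ⟨h3, _⟩
  · exact hc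
  · exact absurd h3 hv

omit [Fintype E] [Fintype V] [DecidableEq V] in
/-- Unless both star edges are open, connections among the vertices other than `a₃` are those of
`closeStar ω`. -/
lemma conn_iff_closeStar (hf₁ : ends f₁ = s(a₃, a₁)) (hf₂ : ends f₂ = s(a₃, a₂))
    (hstar : ∀ e, a₃ ∈ ends e → e = f₁ ∨ e = f₂)
    {ω : Config E} (hnb : ¬ (ω f₁ = true ∧ ω f₂ = true)) {x v : V} (hx : x ≠ a₃) (hv : v ≠ a₃) :
    Conn ends ω x v ↔ Conn ends (closeStar f₁ f₂ ω) x v :=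
  ⟨conn_closeStar_of_conn hf₁ hf₂ hstar hnb hx hv, conn_mono (closeStar_le ω)⟩

end Star

/-! ## The cluster of `a₃` and the events of the star -/

section Events

variable {ends : E → Sym2 V} {f₁ f₂ : E} {a₃ a₁ a₂ : V}

omit [Fintype E] [Fintype V] [DecidableEq V] in
/-- With both star edges closed, `closeStar` is the identity. -/
lemma closeStar_eq_self {ω : Config E} (h1 : ω f₁ = false) (h2 : ω f₂ = false) :
    closeStar f₁ f₂ ω = ω := by
  funext e
  by_cases e1 : e = f₁
  · subst e1; rw [closeStar_apply_f₁, h1]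
  by_cases e2 : e = f₂
  · subst e2; rw [closeStar_apply_f₂, h2]
  rw [closeStar_apply_of_ne e1 e2]

omit [Fintype E] [Fintype V] [DecidableEq V] in
/-- `closeStar` only sees the edges off the star. -/
lemma closeStar_congr {ω ω' : Config E} (h : ∀ e, e ≠ f₁ → e ≠ f₂ → ω e = ω' e) :
    closeStar f₁ f₂ ω = closeStar f₁ f₂ ω' := by
  funext e
  by_cases e1 : e = f₁
  · subst e1; rw [closeStar_apply_f₁, closeStar_apply_f₁]
  by_cases e2 : e = f₂
  · subst e2; rw [closeStar_apply_f₂, closeStar_apply_f₂]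
  rw [closeStar_apply_of_ne e1 e2, closeStar_apply_of_ne e1 e2, h e e1 e2]

omit [Fintype E] [Fintype V] [DecidableEq V] in
/-- Both star edges closed: `C(a₃) = {a₃}`. -/
lemma cluster_a3_closed (hstar : ∀ e, a₃ ∈ ends e → e = f₁ ∨ e = f₂) {ω : Config E}
    (h1 : ω f₁ = false) (h2 : ω f₂ = false) : cluster ends ω a₃ = {a₃} := by
  ext x
  simp only [mem_cluster, Set.mem_singleton_iff]
  constructor
  · intro h
    by_contra hx
    have hx' : x ≠ a₃ := hx
    have := not_conn_closeStar_a3 (f₁ := f₁) (f₂ := f₂) hstar (ω := ω) hx'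
    rw [closeStar_eq_self h1 h2] at this
    exact this (conn_symm h)
  · rintro rfl; exact conn_refl ends ω x

omit [Fintype E] [DecidableEq E] [Fintype V] [DecidableEq V] in
/-- `f₂` open: `C(a₃) = C(a₂)`. -/
lemma cluster_a3_open₂ (hf₂ : ends f₂ = s(a₃, a₂)) {ω : Config E} (h2 : ω f₂ = true) :
    cluster ends ω a₃ = cluster ends ω a₂ :=
  cluster_eq_of_conn (conn_of_openAdj ⟨f₂, h2, hf₂⟩)

omit [Fintype E] [DecidableEq E] [Fintype V] [DecidableEq V] in
/-- `f₁` open: `C(a₃) = C(a₁)`. -/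
lemma cluster_a3_open₁ (hf₁ : ends f₁ = s(a₃, a₁)) {ω : Config E} (h1 : ω f₁ = true) :
    cluster ends ω a₃ = cluster ends ω a₁ :=
  cluster_eq_of_conn (conn_of_openAdj ⟨f₁, h1, hf₁⟩)

omit [Fintype E] [DecidableEq E] [Fintype V] [DecidableEq V] in
/-- A Boolean that is not `false` is `true`. -/
lemma bool_true_of_ne_false {b : Bool} (h : ¬ b = false) : b = true := by
  cases b
  · exact absurd rfl h
  · rfl

/-- The star-free connection event `{x ↔ v}` with both star edges closed. -/
def connEvent₀ (ends : E → Sym2 V) (f₁ f₂ : E) (x v : V) : Set (Config E) :=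
  {ω | Conn ends (closeStar f₁ f₂ ω) x v}

omit [Fintype E] [Fintype V] [DecidableEq V] in
/-- Membership in `connEvent₀`. -/
@[simp] lemma mem_connEvent₀ {x v : V} {ω : Config E} :
    ω ∈ connEvent₀ ends f₁ f₂ x v ↔ Conn ends (closeStar f₁ f₂ ω) x v := Iff.rfl

omit [Fintype E] [Fintype V] [DecidableEq V] in
/-- `connEvent₀` is determined by the edges off the star. -/
lemma dependsOn_connEvent₀ (x v : V) :
    DependsOn (· ∈ connEvent₀ ends f₁ f₂ x v) ({f₁, f₂}ᶜ : Set E) := by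
  intro ω ω' h
  show Conn ends (closeStar f₁ f₂ ω) x v = Conn ends (closeStar f₁ f₂ ω') x v
  rw [closeStar_congr fun e e1 e2 => h e (by simp [e1, e2])]

omit [Fintype E] [Fintype V] [DecidableEq V] in
/-- Off `{both open}`, a connection among the other vertices is the star-free one. -/
lemma connEvent_inter_eq (hf₁ : ends f₁ = s(a₃, a₁)) (hf₂ : ends f₂ = s(a₃, a₂))
    (hstar : ∀ e, a₃ ∈ ends e → e = f₁ ∨ e = f₂) {x v : V} (hx : x ≠ a₃) (hv : v ≠ a₃)
    (B : Set (Config E)) (hB : ∀ ω ∈ B, ¬ (ω f₁ = true ∧ ω f₂ = true)) :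
    connEvent ends x v ∩ B = connEvent₀ ends f₁ f₂ x v ∩ B := by
  ext ω
  simp only [Set.mem_inter_iff, connEvent, Set.mem_setOf_eq, mem_connEvent₀]
  constructor
  · rintro ⟨h, hω⟩; exact ⟨(conn_iff_closeStar hf₁ hf₂ hstar (hB ω hω) hx hv).1 h, hω⟩
  · rintro ⟨h, hω⟩; exact ⟨(conn_iff_closeStar hf₁ hf₂ hstar (hB ω hω) hx hv).2 h, hω⟩

/-- The star-free `Q`: `{a₁ ↮ a₂}` with both star edges closed. -/
def Q₀ (ends : E → Sym2 V) (f₁ f₂ : E) (a₁ a₂ : V) : Set (Config E) :=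
  (connEvent₀ ends f₁ f₂ a₁ a₂)ᶜ

omit [Fintype E] [Fintype V] [DecidableEq V] in
/-- `Q₀` is determined by the edges off the star. -/
lemma dependsOn_Q₀ (a₁ a₂ : V) : DependsOn (· ∈ Q₀ ends f₁ f₂ a₁ a₂) ({f₁, f₂}ᶜ : Set E) :=
  dependsOn_compl (dependsOn_connEvent₀ a₁ a₂)

omit [Fintype E] [DecidableEq E] [Fintype V] [DecidableEq V] in
/-- Both star edges open connect the roots. -/
lemma conn_roots_of_both (hf₁ : ends f₁ = s(a₃, a₁)) (hf₂ : ends f₂ = s(a₃, a₂)) {ω : Config E}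
    (h1 : ω f₁ = true) (h2 : ω f₂ = true) : Conn ends ω a₁ a₂ :=
  conn_trans (conn_symm (conn_of_openAdj ⟨f₁, h1, hf₁⟩)) (conn_of_openAdj ⟨f₂, h2, hf₂⟩)

omit [Fintype E] [Fintype V] [DecidableEq V] in
/-- **`Q = Q₀ ∩ {not both open}`**. -/
lemma avoidAll_star (hf₁ : ends f₁ = s(a₃, a₁)) (hf₂ : ends f₂ = s(a₃, a₂))
    (hstar : ∀ e, a₃ ∈ ends e → e = f₁ ∨ e = f₂) (h31 : a₃ ≠ a₁) (h32 : a₃ ≠ a₂) :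
    avoidAll ends a₂ {a₁} = Q₀ ends f₁ f₂ a₁ a₂ ∩ (closedEdge f₁ ∪ closedEdge f₂) := by
  rw [avoidAll_eq_compl]
  ext ω
  simp only [Set.mem_compl_iff, connEvent, Set.mem_setOf_eq, Set.mem_inter_iff, Q₀,
    mem_connEvent₀, Set.mem_union, mem_closedEdge]
  by_cases hnb : ω f₁ = true ∧ ω f₂ = true
  · have := conn_roots_of_both hf₁ hf₂ hnb.1 hnb.2
    simp [this, hnb.1, hnb.2]
  · have hor : ω f₁ = false ∨ ω f₂ = false := by
      by_cases h1 : ω f₁ = false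
      · exact Or.inl h1
      · right
        by_contra h2
        exact hnb ⟨bool_true_of_ne_false h1, bool_true_of_ne_false h2⟩
    rw [conn_iff_closeStar hf₁ hf₂ hstar hnb (Ne.symm h31) (Ne.symm h32)]
    simp [hor]

omit [Fintype E] [Fintype V] [DecidableEq V] in
/-- **`PD = Q₀ ∩ {f₁ closed} ∩ {f₂ closed}`**. -/
lemma PDEvent_star (hf₁ : ends f₁ = s(a₃, a₁)) (hf₂ : ends f₂ = s(a₃, a₂))
    (hstar : ∀ e, a₃ ∈ ends e → e = f₁ ∨ e = f₂) (h31 : a₃ ≠ a₁) (h32 : a₃ ≠ a₂) :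
    PDEvent ends a₁ a₂ a₃ = Q₀ ends f₁ f₂ a₁ a₂ ∩ (closedEdge f₁ ∩ closedEdge f₂) := by
  unfold PDEvent Dtilde inU
  ext ω
  simp only [Set.mem_inter_iff, Set.mem_compl_iff, connEvent, Set.mem_setOf_eq, Q₀,
    mem_connEvent₀, mem_closedEdge, Set.mem_union, not_or]
  constructor
  · rintro ⟨hQ, h1, h2⟩
    have e1 : ω f₁ = false := by
      by_contra hc
      exact h1 (conn_of_openAdj ⟨f₁, bool_true_of_ne_false hc, hf₁⟩)
    have e2 : ω f₂ = false := by
      by_contra hc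
      exact h2 (conn_of_openAdj ⟨f₂, bool_true_of_ne_false hc, hf₂⟩)
    refine ⟨?_, e1, e2⟩
    rwa [closeStar_eq_self e1 e2]
  · rintro ⟨hQ, e1, e2⟩
    rw [closeStar_eq_self e1 e2] at hQ
    have hiso := cluster_a3_closed (f₁ := f₁) (f₂ := f₂) hstar e1 e2
    refine ⟨hQ, fun h => ?_, fun h => ?_⟩
    · have : a₁ ∈ cluster ends ω a₃ := h
      rw [hiso] at this
      exact h31 (Set.mem_singleton_iff.1 this).symm
    · have : a₂ ∈ cluster ends ω a₃ := h
      rw [hiso] at this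
      exact h32 (Set.mem_singleton_iff.1 this).symm

omit [Fintype E] [Fintype V] [DecidableEq V] in
/-- **`T = Q₀ ∩ {f₁ closed} ∩ {f₂ open}`**. -/
lemma TEvent_star (hf₁ : ends f₁ = s(a₃, a₁)) (hf₂ : ends f₂ = s(a₃, a₂))
    (hstar : ∀ e, a₃ ∈ ends e → e = f₁ ∨ e = f₂) (h31 : a₃ ≠ a₁) (h32 : a₃ ≠ a₂) :
    TEvent ends a₁ a₂ a₃ = Q₀ ends f₁ f₂ a₁ a₂ ∩ (closedEdge f₁ ∩ openEdge f₂) := by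
  unfold TEvent
  ext ω
  simp only [Set.mem_inter_iff, Set.mem_compl_iff, connEvent, Set.mem_setOf_eq, Q₀,
    mem_connEvent₀, mem_closedEdge, mem_openEdge]
  constructor
  · rintro ⟨hQ, h23⟩
    have e1 : ω f₁ = false := by
      by_contra hc
      exact hQ (conn_trans h23 (conn_of_openAdj ⟨f₁, bool_true_of_ne_false hc, hf₁⟩))
    have e2 : ω f₂ = true := by
      by_contra hc
      have e2' : ω f₂ = false := Bool.eq_false_iff.2 hc
      have hiso := cluster_a3_closed (f₁ := f₁) (f₂ := f₂) hstar e1 e2'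
      have : a₂ ∈ cluster ends ω a₃ := conn_symm h23
      rw [hiso] at this
      exact h32 (Set.mem_singleton_iff.1 this).symm
    have hnb : ¬ (ω f₁ = true ∧ ω f₂ = true) := fun h => by rw [h.1] at e1; exact Bool.true_eq_false.mp e1
    refine ⟨fun h => hQ ?_, e1, e2⟩
    exact conn_symm ((conn_iff_closeStar hf₁ hf₂ hstar hnb (Ne.symm h31) (Ne.symm h32)).2 h)
  · rintro ⟨hQ, e1, e2⟩
    have hnb : ¬ (ω f₁ = true ∧ ω f₂ = true) := fun h => by rw [h.1] at e1; exact Bool.true_eq_false.mp e1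
    refine ⟨fun h => hQ ?_, conn_of_openAdj ⟨f₂, e2, by rw [hf₂, Sym2.eq_swap]⟩⟩
    exact (conn_iff_closeStar hf₁ hf₂ hstar hnb (Ne.symm h31) (Ne.symm h32)).1 (conn_symm h)

omit [Fintype E] [Fintype V] [DecidableEq V] in
/-- **`T′ = Q₀ ∩ {f₁ open} ∩ {f₂ closed}`** (the mirror). -/
lemma TEvent'_star (hf₁ : ends f₁ = s(a₃, a₁)) (hf₂ : ends f₂ = s(a₃, a₂))
    (hstar : ∀ e, a₃ ∈ ends e → e = f₁ ∨ e = f₂) (h31 : a₃ ≠ a₁) (h32 : a₃ ≠ a₂) :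
    TEvent ends a₂ a₁ a₃ = Q₀ ends f₁ f₂ a₁ a₂ ∩ (openEdge f₁ ∩ closedEdge f₂) := by
  have h := TEvent_star (ends := ends) (f₁ := f₂) (f₂ := f₁) hf₂ hf₁
    (fun e he => (hstar e he).symm) h32 h31
  rw [h]
  ext ω
  simp only [Set.mem_inter_iff, Q₀, Set.mem_compl_iff, mem_connEvent₀]
  have e : closeStar f₂ f₁ ω = closeStar f₁ f₂ ω := by
    funext e
    by_cases e1 : e = f₁
    · subst e1; rw [closeStar_apply_f₁, closeStar_apply_f₂]
    by_cases e2 : e = f₂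
    · subst e2; rw [closeStar_apply_f₁, closeStar_apply_f₂]
    rw [closeStar_apply_of_ne e2 e1, closeStar_apply_of_ne e1 e2]
  rw [e]
  constructor
  · rintro ⟨hQ, h2, h1⟩; exact ⟨fun h => hQ (conn_symm h), h1, h2⟩
  · rintro ⟨hQ, h1, h2⟩; exact ⟨fun h => hQ (conn_symm h), h2, h1⟩

end Events

end HMFTwoRoot

end Summit.Ventures.PercRepro2
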